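import Summits.Ventures.PercRepro.RankLevelSetStarPlusSeries
import Summits.Ventures.PercRepro.RankLevelSetAbsorbStarNullityGen
import Summits.Ventures.PercRepro.RankLevelSetCellPropsClasses

/-! # RankLevelSetCellPropsCosimple — ALL FIVE PROPS ON EVERY SIMPLE COSIMPLE MATROID OF NULLITY `≤ 4` (night-1 g37;
dossier §49.9; on `RankLevelSetStarPlusSeries`, `RankLevelSetAbsorbStarNullityGen`, `RankLevelSetCellPropsClasses`)

The single up-shadow step of `RankLevelSetAbsorbStarNullityGen` proves the (ABS-star) step `k` on a coloop-free
matroid with `rk M✶ ≤ ρ + 1` when `#E ≥ kρ + 1`; with the refined coloop bound of `RankLevelSetStarPlusSeries`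
(no parallel pair of `M✶` inside the hyperplane, i.e. no SERIES PAIR of `M` disjoint from the circuit) the same
argument needs only `#E ≥ k(ρ − 1) + 1` (**`absorbStar_perCircuit_of_no_pair`**, **`absorbStar_step_of_no_pair`**):
on nullity `≤ 4` (`ρ = 2`) EVERY step `k ≥ 4` up to and including the middle `#E = 2k + 1`
(**`absorbStar_step_of_nullity_four_no_pair`**). Likewise the per-circuit reflection of (★★)⁺ closes at every level
`i ≥ 4` on nullity `≤ 4` (**`starPlus_perCircuit_of_nullity_four_no_pair`**, **`starPlus_of_nullity_four_no_pair`**).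
Hence, on a SIMPLE (no loops, no parallel pairs) and COSIMPLE (every cocircuit has `≥ 3` elements: no coloops, no
series pairs) matroid of nullity `≤ 4`, (ABS-star) and (★★)⁺ hold at every element and every level (the steps
`k ≤ 3` and the levels `≤ 3` are the theorems of the tree for every matroid), hence (ABS-norm)
(`absorbNormSkew_of_absorbStar`), and with `biIndepPerElem_of_nullity` / `biIndepMono_of_nullity`:
**`cellProps_of_simple_cosimple_of_nullity_four`** — the five Props of the cell on every simple cosimple matroid of
nullity `≤ 4`, one beyond `cellProps_of_nullity` (nullity `≤ 3`, every matroid). Every declaration has a docstring;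
imports: the cell's own modules and Mathlib only. Axioms: standard. -/

namespace PercRepro

open Set Matroid

variable {α : Type} (M : Matroid α) [M.Finite]

/-! ## The (ABS-star) single step with the refined coloop bound -/

/-- **THE PER-CIRCUIT (ABS-star) STEP WITH THE REFINED COLOOP BOUND** (coloop-free `M`, `y` in no parallel pair,
`rk M✶ ≤ ρ + 2`, `1 ≤ ρ`, `4 ≤ k`, `2k + 1 ≤ #E`, `kρ + 1 ≤ #E`): for an absorbing `k`-set `Z₀` whose circuit's
complement contains no parallel pair of `M✶`, `(#E − 1 − k) · #members(K, k) ≤ k · #members(K, k + 1)` — the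
computation of `absorbStar_perCircuit_of_eRank_dual` with the hyperplane rank `ρ + 1` and the step
`absorbFam_step_of_no_pair`. -/
theorem absorbStar_perCircuit_of_no_pair (hcol : ∀ e, ¬ M.IsColoop e) {y : α} (hy : y ∈ M.E)
    (hnp : ∀ z, z ≠ y → y ∉ M.closure {z}) {ρ : ℕ} (hν : M✶.eRank ≤ ρ + 2) (hρ1 : 1 ≤ ρ) {k : ℕ} (hk4 : 4 ≤ k)
    (hk : 2 * k + 1 ≤ M.E.ncard) (hkρ : k * ρ + 1 ≤ M.E.ncard) {Z₀ : Set α} (hZ₀ : Z₀ ∈ lowAbsorbAt M y k)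
    (hnp2 : ∀ p ∈ M.E \ M.fundCircuit y Z₀, ∀ q ∈ M.E \ M.fundCircuit y Z₀, p ≠ q → q ∉ M✶.closure {p}) :
    (M.E.ncard - 1 - k) * {Z ∈ lowAbsorbAt M y k | M.fundCircuit y Z = M.fundCircuit y Z₀}.ncard ≤
      k * {Z ∈ lowAbsorbAt M y (k + 1) | M.fundCircuit y Z = M.fundCircuit y Z₀}.ncard := by
  obtain ⟨hKeq, hSZ, hSE, hHE, -, -, hHy, hyH, hnl, -⟩ := circuit_dual_facts M hcol hy hZ₀
  have h1 := members_le_fam M hy hZ₀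
  have h2 := fam_le_absorb M hy hZ₀ (k + 1 - (M.fundCircuit y Z₀ \ {y}).ncard)
  obtain ⟨z₀, hz₀⟩ : (M.E \ {y}).Nonempty := by
    rw [← Set.ncard_pos (M.ground_finite.subset Set.sdiff_subset), Set.ncard_sdiff_singleton_of_mem hy]
    omega
  have hz₀y : z₀ ≠ y := by simpa using hz₀.2
  have hK3 := (fundCircuit_ncard_absorb M hy hnp hz₀y hZ₀).1
  have hZE : Z₀ ⊆ M.E := hZ₀.1.1
  have hZk : Z₀.ncard = k := hZ₀.1.2.1
  set K := M.fundCircuit y Z₀ with hK'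
  set S := K \ {y} with hS
  set H := M.E \ K with hH
  have hyK : y ∈ K := M.mem_fundCircuit y Z₀
  have hKE : K ⊆ M.E := hKeq ▸ Set.insert_subset hy hSE
  have hKfin : K.Finite := M.ground_finite.subset hKE
  have hKcard : K.ncard = S.ncard + 1 := by
    rw [hS, Set.ncard_sdiff_singleton_of_mem hyK]
    have : 1 ≤ K.ncard := (Set.ncard_pos hKfin).mpr ⟨y, hyK⟩
    omega
  have hKle : K.ncard ≤ M.E.ncard := Set.ncard_le_ncard hKE M.ground_finite
  have hHcard : H.ncard + K.ncard = M.E.ncard := by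
    rw [hH, Set.ncard_sdiff hKE hKfin]; omega
  have hsk : S.ncard ≤ k := by
    rw [← hZk]; exact Set.ncard_le_ncard hSZ (M.ground_finite.subset hZE)
  have hyE' : y ∈ M✶.E := by rwa [Matroid.dual_ground]
  have hHE' : H ⊆ M✶.E := by rwa [Matroid.dual_ground]
  have hSE' : S ⊆ M✶.E := by rwa [Matroid.dual_ground]
  -- the hyperplane has dual rank at most `ρ + 1`
  have hρ : M✶.eRk H ≤ ((ρ + 1 : ℕ) : ℕ∞) := by
    have h : M✶.eRk H + 1 ≤ ((ρ + 1 : ℕ) : ℕ∞) + 1 := by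
      rw [eRk_add_one_eq_eRank_of_spanning_insert hyE' hyH hHy]
      exact_mod_cast hν
    exact (WithTop.add_le_add_iff_right (by decide)).mp h
  have hs2 : 2 ≤ S.ncard := by omega
  -- the bookkeeping: `k = s + d`, `ρ = 1 + ρ'`, `#E − 1 − k = a ≥ kρ'`, `a = c + ρ'`, `#H = a + d`
  obtain ⟨d, hd⟩ := Nat.exists_eq_add_of_le hsk
  obtain ⟨ρ', hρ'⟩ := Nat.exists_eq_add_of_le hρ1
  obtain ⟨a, ha⟩ : ∃ a, M.E.ncard - 1 - k = a := ⟨_, rfl⟩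
  have hkρ2 : k * ρ' + k + 1 ≤ M.E.ncard := by
    have : k * ρ = k * ρ' + k := by rw [hρ', Nat.mul_add, Nat.mul_one, Nat.add_comm]
    omega
  have hka : k * ρ' ≤ a := by omega
  have h4ρ : 4 * ρ' ≤ k * ρ' := Nat.mul_le_mul_right ρ' hk4
  obtain ⟨c, hc⟩ : ∃ c, a = c + ρ' := ⟨a - ρ', by
    have : ρ' ≤ k * ρ' := Nat.le_mul_of_pos_left ρ' (by omega)
    omega⟩
  have hside : k - S.ncard + (ρ + 1) < H.ncard := by omega
  have hstep := absorbFam_step_of_no_pair (S := S) hHE' hSE' hyE' hyH hHy hnl hnp2 hρ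
    (i := k - S.ncard) hside
  have e1 : k + 1 - S.ncard = k - S.ncard + 1 := by omega
  rw [e1] at h2
  set f : ℕ → ℕ := fun i =>
    {X | X ⊆ H ∧ X.ncard = i ∧ M✶.Spanning (S ∪ X) ∧ M✶.Spanning (insert y (H \ X))}.ncard with hf
  have hstep' : (H.ncard - (k - S.ncard) - (ρ - 1)) * f (k - S.ncard) ≤
      (k - S.ncard + 1) * f (k - S.ncard + 1) := by
    have e : H.ncard - (k - S.ncard) - (ρ + 1 - 2) = H.ncard - (k - S.ncard) - (ρ - 1) := by omega
    rw [e] at hstep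
    exact hstep
  have hm : {Z ∈ lowAbsorbAt M y k | M.fundCircuit y Z = K}.ncard ≤ f (k - S.ncard) := h1
  have ht : f (k - S.ncard + 1) ≤ {Z ∈ lowAbsorbAt M y (k + 1) | M.fundCircuit y Z = K}.ncard := by
    have := h2
    rwa [show k - S.ncard + 1 + S.ncard = k + 1 by omega] at this
  have hcoef : (M.E.ncard - 1 - k) * (k - S.ncard + 1) ≤ k * (H.ncard - (k - S.ncard) - (ρ - 1)) := by
    obtain ⟨s', hs'⟩ := Nat.exists_eq_add_of_le hs2
    have e1 : M.E.ncard - 1 - k = c + ρ' := by omega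
    have e2 : k - S.ncard + 1 = d + 1 := by omega
    have e3 : H.ncard - (k - S.ncard) - (ρ - 1) = c := by omega
    have hc2 : (2 + s' + d) * ρ' ≤ c + ρ' := by rw [← hs', ← hd]; omega
    rw [e1, e2, e3, hd, hs']
    nlinarith [hc2, Nat.zero_le (s' * c), Nat.zero_le (s' * ρ')]
  have key : (k - S.ncard + 1) * ((M.E.ncard - 1 - k) * f (k - S.ncard)) ≤
      (k - S.ncard + 1) * (k * f (k - S.ncard + 1)) := by
    calc (k - S.ncard + 1) * ((M.E.ncard - 1 - k) * f (k - S.ncard))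
        = ((M.E.ncard - 1 - k) * (k - S.ncard + 1)) * f (k - S.ncard) := by ring
      _ ≤ (k * (H.ncard - (k - S.ncard) - (ρ - 1))) * f (k - S.ncard) := Nat.mul_le_mul_right _ hcoef
      _ = k * ((H.ncard - (k - S.ncard) - (ρ - 1)) * f (k - S.ncard)) := by ring
      _ ≤ k * ((k - S.ncard + 1) * f (k - S.ncard + 1)) := Nat.mul_le_mul_left _ hstep'
      _ = (k - S.ncard + 1) * (k * f (k - S.ncard + 1)) := by ring
  have key' := Nat.le_of_mul_le_mul_left key (by omega)
  calc (M.E.ncard - 1 - k) * {Z ∈ lowAbsorbAt M y k | M.fundCircuit y Z = K}.ncard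
      ≤ (M.E.ncard - 1 - k) * f (k - S.ncard) := Nat.mul_le_mul_left _ hm
    _ ≤ k * f (k - S.ncard + 1) := key'
    _ ≤ k * {Z ∈ lowAbsorbAt M y (k + 1) | M.fundCircuit y Z = K}.ncard := Nat.mul_le_mul_left _ ht

/-- **(ABS-star) AT EVERY STEP `k ≥ 4` WITH `#E ≥ kρ + 1` ON A COLOOP-FREE MATROID WITHOUT A SERIES PAIR AND WITH
`rk M✶ ≤ ρ + 2`, AT AN ELEMENT IN NO PARALLEL PAIR** (`2k + 1 ≤ #E`): `(#E − 1 − k) · A^y_k ≤ k · A^y_{k+1}`. -/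
theorem absorbStar_step_of_no_pair (hcol : ∀ e, ¬ M.IsColoop e)
    (hnp2 : ∀ p q, p ≠ q → M✶.IsNonloop p → q ∉ M✶.closure {p}) {y : α} (hy : y ∈ M.E)
    (hnp : ∀ z, z ≠ y → y ∉ M.closure {z}) {ρ : ℕ} (hν : M✶.eRank ≤ ρ + 2) (hρ1 : 1 ≤ ρ) {k : ℕ} (hk4 : 4 ≤ k)
    (hk : 2 * k + 1 ≤ M.E.ncard) (hkρ : k * ρ + 1 ≤ M.E.ncard) :
    (M.E.ncard - 1 - k) * lowAbsorbCount M y k ≤ k * lowAbsorbCount M y (k + 1) := by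
  unfold lowAbsorbCount
  refine absorbStar_step_of_perCircuit M k (M.E.ncard - 1 - k) k ?_
  intro Z₀ hZ₀
  refine absorbStar_perCircuit_of_no_pair M hcol hy hnp hν hρ1 hk4 hk hkρ hZ₀ ?_
  intro p hp q hq hpq
  have hpnl : M✶.IsNonloop p := by
    refine Matroid.isNonloop_of_not_isLoop (by rw [Matroid.dual_ground]; exact hp.1) ?_
    rw [Matroid.dual_isLoop_iff_isColoop]
    exact hcol p
  exact hnp2 p q hpq hpnl

/-- **(ABS-star) AT EVERY STEP `k ≥ 4` UP TO THE MIDDLE ON A COLOOP-FREE MATROID OF NULLITY `≤ 4` WITHOUT A SERIES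
PAIR, AT AN ELEMENT IN NO PARALLEL PAIR** (`ρ = 2`: the condition `#E ≥ 2k + 1` is the range itself). -/
theorem absorbStar_step_of_nullity_four_no_pair (hcol : ∀ e, ¬ M.IsColoop e)
    (hnp2 : ∀ p q, p ≠ q → M✶.IsNonloop p → q ∉ M✶.closure {p}) {y : α} (hy : y ∈ M.E)
    (hnp : ∀ z, z ≠ y → y ∉ M.closure {z}) (hν : M✶.eRank ≤ 4) {k : ℕ} (hk4 : 4 ≤ k)
    (hk : 2 * k + 1 ≤ M.E.ncard) :
    (M.E.ncard - 1 - k) * lowAbsorbCount M y k ≤ k * lowAbsorbCount M y (k + 1) :=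
  absorbStar_step_of_no_pair M hcol hnp2 hy hnp (ρ := 2) (by exact_mod_cast hν) (by norm_num) hk4 hk
    (by omega)

/-! ## The reflection (★★)⁺ on nullity `≤ 4` with the refined chain -/

/-- **THE PER-CIRCUIT REFLECTION OF (★★)⁺ AT LEVEL `i ≥ 4` ON A COLOOP-FREE MATROID OF NULLITY `≤ 4`** without a
parallel pair of `M✶` in the complement of the circuit (`2i < #E`): the hyperplane has rank `≤ 3`, the refined
chain closes for every circuit (`s ≥ 2 = ρ − 1`). -/
theorem starPlus_perCircuit_of_nullity_four_no_pair (hcol : ∀ e, ¬ M.IsColoop e) {y : α} (hy : y ∈ M.E)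
    (hnp : ∀ z, z ≠ y → y ∉ M.closure {z}) (hν : M✶.eRank ≤ 4) {i : ℕ} (hi4 : 4 ≤ i)
    (hn : 2 * i < M.E.ncard) {Z₀ : Set α} (hZ₀ : Z₀ ∈ lowAbsorbAt M y i)
    (hnp2 : ∀ p ∈ M.E \ M.fundCircuit y Z₀, ∀ q ∈ M.E \ M.fundCircuit y Z₀, p ≠ q → q ∉ M✶.closure {p}) :
    {Z ∈ lowAbsorbAt M y i | M.fundCircuit y Z = M.fundCircuit y Z₀}.ncard ≤
      {Z ∈ lowAbsorbAt M y (M.E.ncard - i) | M.fundCircuit y Z = M.fundCircuit y Z₀}.ncard := by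
  obtain ⟨hKeq, hSZ, hSE, hHE, -, -, hHy, hyH, hnl, -⟩ := circuit_dual_facts M hcol hy hZ₀
  have h1 := members_le_fam M hy hZ₀
  have h2 := fam_le_absorb M hy hZ₀ (M.E.ncard - i - (M.fundCircuit y Z₀ \ {y}).ncard)
  obtain ⟨z₀, hz₀⟩ : (M.E \ {y}).Nonempty := by
    rw [← Set.ncard_pos (M.ground_finite.subset Set.sdiff_subset), Set.ncard_sdiff_singleton_of_mem hy]
    omega
  have hz₀y : z₀ ≠ y := by simpa using hz₀.2
  have hK3 := (fundCircuit_ncard_absorb M hy hnp hz₀y hZ₀).1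
  have hZE : Z₀ ⊆ M.E := hZ₀.1.1
  have hZi : Z₀.ncard = i := hZ₀.1.2.1
  set K := M.fundCircuit y Z₀ with hK'
  set S := K \ {y} with hS
  set H := M.E \ K with hH
  have hyK : y ∈ K := M.mem_fundCircuit y Z₀
  have hKE : K ⊆ M.E := hKeq ▸ Set.insert_subset hy hSE
  have hKfin : K.Finite := M.ground_finite.subset hKE
  have hKcard : K.ncard = S.ncard + 1 := by
    rw [hS, Set.ncard_sdiff_singleton_of_mem hyK]
    have : 1 ≤ K.ncard := (Set.ncard_pos hKfin).mpr ⟨y, hyK⟩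
    omega
  have hKle : K.ncard ≤ M.E.ncard := Set.ncard_le_ncard hKE M.ground_finite
  have hHcard : H.ncard + K.ncard = M.E.ncard := by
    rw [hH, Set.ncard_sdiff hKE hKfin]; omega
  have hsi : S.ncard ≤ i := by
    rw [← hZi]; exact Set.ncard_le_ncard hSZ (M.ground_finite.subset hZE)
  have hyE' : y ∈ M✶.E := by rwa [Matroid.dual_ground]
  have hHE' : H ⊆ M✶.E := by rwa [Matroid.dual_ground]
  have hSE' : S ⊆ M✶.E := by rwa [Matroid.dual_ground]
  have hρ : M✶.eRk H ≤ ((3 : ℕ) : ℕ∞) := by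
    have h : M✶.eRk H + 1 ≤ ((3 : ℕ) : ℕ∞) + 1 := by
      rw [eRk_add_one_eq_eRank_of_spanning_insert hyE' hyH hHy]
      exact_mod_cast hν
    exact (WithTop.add_le_add_iff_right (by decide)).mp h
  have hs2 : 2 ≤ S.ncard := by omega
  set f : ℕ → ℕ := fun j =>
    {X | X ⊆ H ∧ X.ncard = j ∧ M✶.Spanning (S ∪ X) ∧ M✶.Spanning (insert y (H \ X))}.ncard with hf
  have hchain : f (i - S.ncard) ≤ f (M.E.ncard - i - S.ncard) := by
    have hm : M.E.ncard - i - S.ncard = (i - S.ncard) + (M.E.ncard - 2 * i) := by omega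
    rw [hm]
    refine le_of_chain f (c := M.E.ncard - i - 2) (by omega) ?_
    intro t ht
    have hstep := absorbFam_step_of_no_pair (S := S) hHE' hSE' hyE' hyH hHy hnl hnp2 hρ
      (i := i - S.ncard + t) (by omega)
    have e1 : H.ncard - (i - S.ncard + t) - (3 - 2) = M.E.ncard - i - 2 - t := by omega
    rw [e1] at hstep
    exact hstep
  have e2 : M.E.ncard - i - S.ncard + S.ncard = M.E.ncard - i := by omega
  rw [e2] at h2
  calc {Z ∈ lowAbsorbAt M y i | M.fundCircuit y Z = M.fundCircuit y Z₀}.ncard ≤ f (i - S.ncard) := h1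
    _ ≤ f (M.E.ncard - i - S.ncard) := hchain
    _ ≤ _ := h2

/-- **(★★)⁺ AT EVERY LEVEL `i ≥ 4` ON A COLOOP-FREE MATROID OF NULLITY `≤ 4` WITHOUT A SERIES PAIR, AT AN ELEMENT
IN NO PARALLEL PAIR** (`2i < #E`): `A^y_i ≤ A^y_{#E − i}`. -/
theorem starPlus_of_nullity_four_no_pair (hcol : ∀ e, ¬ M.IsColoop e)
    (hnp2 : ∀ p q, p ≠ q → M✶.IsNonloop p → q ∉ M✶.closure {p}) {y : α} (hy : y ∈ M.E)
    (hnp : ∀ z, z ≠ y → y ∉ M.closure {z}) (hν : M✶.eRank ≤ 4) {i : ℕ} (hi4 : 4 ≤ i)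
    (hn : 2 * i < M.E.ncard) : lowAbsorbCount M y i ≤ lowAbsorbCount M y (M.E.ncard - i) := by
  unfold lowAbsorbCount
  refine absorb_le_of_perCircuit_levels M i (M.E.ncard - i) ?_
  intro Z₀ hZ₀
  refine starPlus_perCircuit_of_nullity_four_no_pair M hcol hy hnp hν hi4 hn hZ₀ ?_
  intro p hp q hq hpq
  have hpnl : M✶.IsNonloop p := by
    refine Matroid.isNonloop_of_not_isLoop (by rw [Matroid.dual_ground]; exact hp.1) ?_
    rw [Matroid.dual_isLoop_iff_isColoop]
    exact hcol p
  exact hnp2 p q hpq hpnl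

/-! ## The class theorems: simple cosimple matroids of nullity `≤ 4` -/

/-- **(ABS-star) HOLDS ON EVERY SIMPLE COSIMPLE MATROID OF NULLITY `≤ 4`** (no loops, no parallel pairs, every
cocircuit has `≥ 3` elements, `rk M✶ ≤ 4`): the steps `k ≤ 3` are `absorbStar_of_le_three_all`, the steps `k ≥ 4`
the refined single step per circuit. -/
theorem biIndepAbsorbStar_of_simple_cosimple_of_nullity_four [DecidableEq α] (hl : ∀ e, ¬ M.IsLoop e)
    (hp : ∀ u v, ¬ ParallelPair M u v) (hc : ∀ C, M.IsCocircuit C → 3 ≤ C.ncard) (hν : M✶.eRank ≤ 4) :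
    BiIndepAbsorbStar M := by
  obtain ⟨hcol, hnp2⟩ := no_coloop_and_no_pair_of_cocircuits M hc
  intro y hy k hk
  rcases Nat.lt_or_ge k 4 with h3 | h4
  · exact absorbStar_of_le_three_all M hy (by omega) hk
  · exact absorbStar_step_of_nullity_four_no_pair M hcol hnp2 hy
      (fun _ hz => notMem_closure_singleton_of_no_partner M hy (hl y) (hp y) hz) hν h4 hk

/-- **(★★)⁺ HOLDS ON EVERY SIMPLE COSIMPLE MATROID OF NULLITY `≤ 4`**: the levels `≤ 2` are `starPlus_of_le_two`,
the level `3` is `starPlus_three`, the levels `≥ 4` the refined per-circuit chain. -/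
theorem biIndepStarPlus_of_simple_cosimple_of_nullity_four (hl : ∀ e, ¬ M.IsLoop e)
    (hp : ∀ u v, ¬ ParallelPair M u v) (hc : ∀ C, M.IsCocircuit C → 3 ≤ C.ncard) (hν : M✶.eRank ≤ 4) :
    BiIndepStarPlus M := by
  obtain ⟨hcol, hnp2⟩ := no_coloop_and_no_pair_of_cocircuits M hc
  intro y hy i hi
  rcases Nat.lt_or_ge i 3 with h2 | h3
  · exact starPlus_of_le_two M hy (by omega) hi
  · rcases Nat.lt_or_ge i 4 with h3' | h4
    · have hi3 : i = 3 := by omega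
      subst hi3
      exact starPlus_three M hy (by omega)
    · exact starPlus_of_nullity_four_no_pair M hcol hnp2 hy
        (fun _ hz => notMem_closure_singleton_of_no_partner M hy (hl y) (hp y) hz) hν h4 hi

/-- **(ABS-norm) HOLDS ON EVERY SIMPLE COSIMPLE MATROID OF NULLITY `≤ 4`.** -/
theorem absorbNormSkew_of_simple_cosimple_of_nullity_four [DecidableEq α] (hl : ∀ e, ¬ M.IsLoop e)
    (hp : ∀ u v, ¬ ParallelPair M u v) (hc : ∀ C, M.IsCocircuit C → 3 ≤ C.ncard) (hν : M✶.eRank ≤ 4) :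
    BiIndepAbsorbNormSkew M :=
  absorbNormSkew_of_absorbStar M (biIndepAbsorbStar_of_simple_cosimple_of_nullity_four M hl hp hc hν)
    (biIndepStarPlus_of_simple_cosimple_of_nullity_four M hl hp hc hν)

/-- **ALL FIVE PROPS OF THE CELL HOLD ON EVERY SIMPLE COSIMPLE MATROID OF NULLITY `≤ 4`**: (★★) and Mono on every
matroid of nullity `≤ 4` (`biIndepPerElem_of_nullity`), (ABS-star), (★★)⁺ and (ABS-norm) by the refined chain. -/
theorem cellProps_of_simple_cosimple_of_nullity_four [DecidableEq α] (hl : ∀ e, ¬ M.IsLoop e)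
    (hp : ∀ u v, ¬ ParallelPair M u v) (hc : ∀ C, M.IsCocircuit C → 3 ≤ C.ncard) (hν : M✶.eRank ≤ 4) :
    BiIndepPerElem M ∧ BiIndepMono M ∧ BiIndepAbsorbStar M ∧ BiIndepStarPlus M ∧ BiIndepAbsorbNormSkew M :=
  ⟨biIndepPerElem_of_nullity M hν, biIndepMono_of_nullity M hν,
    biIndepAbsorbStar_of_simple_cosimple_of_nullity_four M hl hp hc hν,
    biIndepStarPlus_of_simple_cosimple_of_nullity_four M hl hp hc hν,
    absorbNormSkew_of_simple_cosimple_of_nullity_four M hl hp hc hν⟩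

end PercRepro
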